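import Summits.Ventures.CertifiedArithmetic.LowPrec.DoubleRounding

/-!
# Double rounding of sums: verdicts for the named formats

HONEST FRAMING (venture CertifiedArithmetic / cell `pub-lowprec`): certified error envelopes and
provably optimal rounding/accumulation schemes for low-precision formats under stated cost models;
every table by two implementations; no hardware or vendor claims.

Instances and counterexamples of `MiniFloat.toRat_roundNE_roundNE_add` ("add two `φ`-data in
`ψ`, convert to `φ`" equals correctly rounded `φ`-addition, saturating RNE both times).
VERDICT TABLE (each cell a theorem below; "thm" = by the theorem with its three parameter
inequalities discharged by `decide`; "exact" = every such sum is itself a `ψ`-value; "NO" =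
kernel-checked counterexample):
* via `binary32`: `E2M1`, `E3M2`, `E2M3`, `E4M3`, `E5M2`, `binary16` (`24 ≥ 2·11+1`), `bfloat16`
  (`24 ≥ 2·8+1`) — all innocuous (thm);
* via `binary16`: `E2M1`, `E3M2`, `E2M3`, `E4M3` (`11 ≥ 9`), `E5M2` (`11 ≥ 7`) innocuous (thm);
  `bfloat16` NO (`a = 1 + 2^-7`, `b = 7·2^-11`: `1 + 2^-6` vs `1 + 2^-7`);
* via `bfloat16`: `E2M1`, `E3M2` (`8 ≥ 7`), `E5M2` (`8 ≥ 7`) innocuous (thm); `E2M3` innocuous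
  although `8 < 9` (exact: every `E2M3 + E2M3` is a bfloat16 value); `E4M3` NO (`a = 9/8`,
  `b = 15/256`: `5/4` vs `9/8` — precision `8 = 2·4` is exactly one bit short); `binary16` NO
  (narrower intermediate: `1 + 2^-10 ↦ 1`).
-/

namespace Literature.ComputerArithmetic.FloatingPoint

/-! ### Verdicts for the named formats -/

namespace Format

open MiniFloat

/-- via `binary32`: `E2M1` sums. [cite: Figueroa1995, §2] -/
theorem E2M1_add_via_Binary32 (a b : MiniFloat E2M1) :
    (roundNE E2M1 (roundNE Binary32 (a.toRat + b.toRat)).toRat).toRat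
      = (roundNE E2M1 (a.toRat + b.toRat)).toRat :=
  toRat_roundNE_roundNE_add (by decide) (by decide) (by decide +kernel) a b

/-- via `binary32`: `E3M2` sums. [cite: Figueroa1995, §2] -/
theorem E3M2_add_via_Binary32 (a b : MiniFloat E3M2) :
    (roundNE E3M2 (roundNE Binary32 (a.toRat + b.toRat)).toRat).toRat
      = (roundNE E3M2 (a.toRat + b.toRat)).toRat :=
  toRat_roundNE_roundNE_add (by decide) (by decide) (by decide +kernel) a b

/-- via `binary32`: `E2M3` sums. [cite: Figueroa1995, §2] -/
theorem E2M3_add_via_Binary32 (a b : MiniFloat E2M3) :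
    (roundNE E2M3 (roundNE Binary32 (a.toRat + b.toRat)).toRat).toRat
      = (roundNE E2M3 (a.toRat + b.toRat)).toRat :=
  toRat_roundNE_roundNE_add (by decide) (by decide) (by decide +kernel) a b

/-- via `binary32`: `E4M3` sums. [cite: Figueroa1995, §2] -/
theorem E4M3_add_via_Binary32 (a b : MiniFloat E4M3) :
    (roundNE E4M3 (roundNE Binary32 (a.toRat + b.toRat)).toRat).toRat
      = (roundNE E4M3 (a.toRat + b.toRat)).toRat :=
  toRat_roundNE_roundNE_add (by decide) (by decide) (by decide +kernel) a b

/-- via `binary32`: `E5M2` sums. [cite: Figueroa1995, §2] -/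
theorem E5M2_add_via_Binary32 (a b : MiniFloat E5M2) :
    (roundNE E5M2 (roundNE Binary32 (a.toRat + b.toRat)).toRat).toRat
      = (roundNE E5M2 (a.toRat + b.toRat)).toRat :=
  toRat_roundNE_roundNE_add (by decide) (by decide) (by decide +kernel) a b

/-- via `binary32`: `binary16` sums (`p = 24 ≥ 2·11 + 1`). Computing a binary16 addition in
binary32 and converting back is correctly rounded binary16 addition. [cite: Figueroa1995, §2] -/
theorem Binary16_add_via_Binary32 (a b : MiniFloat Binary16) :
    (roundNE Binary16 (roundNE Binary32 (a.toRat + b.toRat)).toRat).toRat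
      = (roundNE Binary16 (a.toRat + b.toRat)).toRat :=
  toRat_roundNE_roundNE_add (by decide) (by decide) (by decide +kernel) a b

/-- via `binary32`: `bfloat16` sums (`p = 24 ≥ 2·8 + 1`). Computing a bfloat16 addition in
binary32 and converting back is correctly rounded bfloat16 addition. [cite: Figueroa1995, §2] -/
theorem BFloat16_add_via_Binary32 (a b : MiniFloat BFloat16) :
    (roundNE BFloat16 (roundNE Binary32 (a.toRat + b.toRat)).toRat).toRat
      = (roundNE BFloat16 (a.toRat + b.toRat)).toRat :=
  toRat_roundNE_roundNE_add (by decide) (by decide) (by decide +kernel) a b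

/-- via `binary16`: `E2M1` sums. [cite: Figueroa1995, §2] -/
theorem E2M1_add_via_Binary16 (a b : MiniFloat E2M1) :
    (roundNE E2M1 (roundNE Binary16 (a.toRat + b.toRat)).toRat).toRat
      = (roundNE E2M1 (a.toRat + b.toRat)).toRat :=
  toRat_roundNE_roundNE_add (by decide) (by decide) (by decide +kernel) a b

/-- via `binary16`: `E3M2` sums. [cite: Figueroa1995, §2] -/
theorem E3M2_add_via_Binary16 (a b : MiniFloat E3M2) :
    (roundNE E3M2 (roundNE Binary16 (a.toRat + b.toRat)).toRat).toRat
      = (roundNE E3M2 (a.toRat + b.toRat)).toRat :=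
  toRat_roundNE_roundNE_add (by decide) (by decide) (by decide +kernel) a b

/-- via `binary16`: `E2M3` sums. [cite: Figueroa1995, §2] -/
theorem E2M3_add_via_Binary16 (a b : MiniFloat E2M3) :
    (roundNE E2M3 (roundNE Binary16 (a.toRat + b.toRat)).toRat).toRat
      = (roundNE E2M3 (a.toRat + b.toRat)).toRat :=
  toRat_roundNE_roundNE_add (by decide) (by decide) (by decide +kernel) a b

/-- via `binary16`: `E4M3` sums (`p = 11 ≥ 2·4 + 1`). [cite: Figueroa1995, §2] -/
theorem E4M3_add_via_Binary16 (a b : MiniFloat E4M3) :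
    (roundNE E4M3 (roundNE Binary16 (a.toRat + b.toRat)).toRat).toRat
      = (roundNE E4M3 (a.toRat + b.toRat)).toRat :=
  toRat_roundNE_roundNE_add (by decide) (by decide) (by decide +kernel) a b

/-- via `binary16`: `E5M2` sums (`p = 11 ≥ 2·3 + 1`; ranges `57344 ≤ 65504`, sums beyond
binary16's range saturate consistently). [cite: Figueroa1995, §2] -/
theorem E5M2_add_via_Binary16 (a b : MiniFloat E5M2) :
    (roundNE E5M2 (roundNE Binary16 (a.toRat + b.toRat)).toRat).toRat
      = (roundNE E5M2 (a.toRat + b.toRat)).toRat :=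
  toRat_roundNE_roundNE_add (by decide) (by decide) (by decide +kernel) a b

/-- via `bfloat16`: `E2M1` sums. [cite: Figueroa1995, §2] -/
theorem E2M1_add_via_BFloat16 (a b : MiniFloat E2M1) :
    (roundNE E2M1 (roundNE BFloat16 (a.toRat + b.toRat)).toRat).toRat
      = (roundNE E2M1 (a.toRat + b.toRat)).toRat :=
  toRat_roundNE_roundNE_add (by decide) (by decide) (by decide +kernel) a b

/-- via `bfloat16`: `E3M2` sums (`p = 8 ≥ 2·3 + 1`, non-trivially: `28 + 1/16` is not a bfloat16
value). [cite: Figueroa1995, §2] -/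
theorem E3M2_add_via_BFloat16 (a b : MiniFloat E3M2) :
    (roundNE E3M2 (roundNE BFloat16 (a.toRat + b.toRat)).toRat).toRat
      = (roundNE E3M2 (a.toRat + b.toRat)).toRat :=
  toRat_roundNE_roundNE_add (by decide) (by decide) (by decide +kernel) a b

/-- via `bfloat16`: `E5M2` sums (`p = 8 ≥ 2·3 + 1`). [cite: Figueroa1995, §2] -/
theorem E5M2_add_via_BFloat16 (a b : MiniFloat E5M2) :
    (roundNE E5M2 (roundNE BFloat16 (a.toRat + b.toRat)).toRat).toRat
      = (roundNE E5M2 (a.toRat + b.toRat)).toRat :=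
  toRat_roundNE_roundNE_add (by decide) (by decide) (by decide +kernel) a b

/-- via `bfloat16`: `E2M3` sums are innocuous although `p = 8 < 2·4 + 1` — for the trivial reason
that every sum of two `E2M3` data (a multiple of `1/8` of magnitude `≤ 15`) IS a bfloat16 value.
[folklore] -/
theorem E2M3_add_exact_in_BFloat16 (a b : MiniFloat E2M3) :
    ∃ z : MiniFloat BFloat16, z.toRat = a.toRat + b.toRat := by
  refine exists_toRat_eq_of_isFloat ⟨a.toInt + b.toInt, E2M3.qexp, ?_, by decide, ?_⟩ ?_
  · have ha : a.toInt.natAbs ≤ 60 := by rw [natAbs_toInt]; exact a.scaledMag_le_maxScaled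
    have hb : b.toInt.natAbs ≤ 60 := by rw [natAbs_toInt]; exact b.scaledMag_le_maxScaled
    have h : (a.toInt + b.toInt).natAbs ≤ 120 := le_trans (Int.natAbs_add_le _ _) (by omega)
    have h' : |a.toInt + b.toInt| ≤ 120 := by
      rw [← Int.natCast_natAbs]; exact_mod_cast h
    exact lt_of_le_of_lt h' (by decide)
  · rw [toRat_add_toRat]; rfl
  · calc |a.toRat + b.toRat| ≤ |a.toRat| + |b.toRat| := abs_add_le _ _
      _ ≤ E2M3.maxRat + E2M3.maxRat :=
          add_le_add (abs_toRat_le_maxRat a) (abs_toRat_le_maxRat b)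
      _ ≤ BFloat16.maxRat := by rw [E2M3_maxRat.1, BFloat16_maxRat.1]; norm_num

/-- via `bfloat16`: `E2M3` sums (by exactness, not by the theorem). [folklore] -/
theorem E2M3_add_via_BFloat16 (a b : MiniFloat E2M3) :
    (roundNE E2M3 (roundNE BFloat16 (a.toRat + b.toRat)).toRat).toRat
      = (roundNE E2M3 (a.toRat + b.toRat)).toRat :=
  toRat_roundNE_roundNE_of_exists (E2M3_add_exact_in_BFloat16 a b)

/-! ### Counterexamples: one bit short, and narrower intermediates -/

/-- `E4M3` via `bfloat16` is NOT innocuous (`p = 8 = 2·4`, one bit short of Figueroa's bound):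
`a = 9/8`, `b = 15/256` (both `E4M3`), `a + b = 303/256`; bfloat16 rounds it to the `E4M3`
midpoint `304/256 = 19/16` (a tie, to even), which `E4M3` then rounds to the even `5/4`; the
correctly rounded `E4M3` sum is `9/8`. Kernel-checked. [cite: Figueroa1995, §2] -/
theorem E4M3_add_via_BFloat16_counterexample :
    let a : MiniFloat E4M3 := ⟨false, 7, 1, by decide, by decide, by decide⟩
    let b : MiniFloat E4M3 := ⟨false, 2, 7, by decide, by decide, by decide⟩
    a.toRat = 9 / 8 ∧ b.toRat = 15 / 256 ∧
    (roundNE BFloat16 (a.toRat + b.toRat)).toRat = 19 / 16 ∧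
    (roundNE E4M3 (roundNE BFloat16 (a.toRat + b.toRat)).toRat).toRat = 5 / 4 ∧
    (roundNE E4M3 (a.toRat + b.toRat)).toRat = 9 / 8 := by
  decide +kernel

/-- Hence the general statement fails for (`E4M3`, `bfloat16`). [cite: Figueroa1995, §2] -/
theorem E4M3_add_via_BFloat16_not_innocuous :
    ¬ ∀ a b : MiniFloat E4M3, (roundNE E4M3 (roundNE BFloat16 (a.toRat + b.toRat)).toRat).toRat
      = (roundNE E4M3 (a.toRat + b.toRat)).toRat := by
  intro h
  have h1 := h ⟨false, 7, 1, by decide, by decide, by decide⟩ ⟨false, 2, 7, by decide, by decide, by decide⟩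
  obtain ⟨-, -, -, h2, h3⟩ := E4M3_add_via_BFloat16_counterexample
  rw [h2, h3] at h1
  norm_num at h1

/-- `bfloat16` via `binary16` is NOT innocuous (`p = 11 < 2·8 + 1`, and the range is too small as
well): `a = 1 + 2^-7`, `b = 7·2^-11` (both bfloat16), `a + b = 1 + 23·2^-11`; binary16 rounds
it to the bfloat16 midpoint `1 + 3·2^-8` (tie, to even), which bfloat16 rounds to the even
`1 + 2^-6`; the correctly rounded bfloat16 sum is `1 + 2^-7`. Kernel-checked. [cite: Figueroa1995, §2] -/
theorem BFloat16_add_via_Binary16_counterexample :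
    let a : MiniFloat BFloat16 := ⟨false, 127, 1, by decide, by decide, by decide⟩
    let b : MiniFloat BFloat16 := ⟨false, 118, 96, by decide, by decide, by decide⟩
    a.toRat = 1 + 1 / 2 ^ 7 ∧ b.toRat = 7 / 2 ^ 11 ∧
    (roundNE Binary16 (a.toRat + b.toRat)).toRat = 1 + 3 / 2 ^ 8 ∧
    (roundNE BFloat16 (roundNE Binary16 (a.toRat + b.toRat)).toRat).toRat = 1 + 1 / 2 ^ 6 ∧
    (roundNE BFloat16 (a.toRat + b.toRat)).toRat = 1 + 1 / 2 ^ 7 := by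
  decide +kernel

/-- Hence the general statement fails for (`bfloat16`, `binary16`). [cite: Figueroa1995, §2] -/
theorem BFloat16_add_via_Binary16_not_innocuous :
    ¬ ∀ a b : MiniFloat BFloat16,
      (roundNE BFloat16 (roundNE Binary16 (a.toRat + b.toRat)).toRat).toRat
        = (roundNE BFloat16 (a.toRat + b.toRat)).toRat := by
  intro h
  have h1 := h ⟨false, 127, 1, by decide, by decide, by decide⟩
    ⟨false, 118, 96, by decide, by decide, by decide⟩
  obtain ⟨-, -, -, h2, h3⟩ := BFloat16_add_via_Binary16_counterexample
  rw [h2, h3] at h1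
  norm_num at h1

/-- `binary16` via `bfloat16` (a NARROWER intermediate) fails already on exact sums:
`(1 + 2^-10) + 0` is a binary16 value that bfloat16 rounds to `1`. [folklore] -/
theorem Binary16_add_via_BFloat16_counterexample :
    let a : MiniFloat Binary16 := ⟨false, 15, 1, by decide, by decide, by decide⟩
    (roundNE Binary16 (roundNE BFloat16 (a.toRat + (MiniFloat.zero Binary16).toRat)).toRat).toRat
        = 1 ∧
    (roundNE Binary16 (a.toRat + (MiniFloat.zero Binary16).toRat)).toRat = 1 + 1 / 2 ^ 10 := by
  decide +kernel

/-! ### Small formats settled by exhaustion (appended 2026-08-20, lean seat gen 3)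

For the FP4/FP6/FP8 formats as BOTH narrow and wide format the precision hypothesis
`2·m_φ + 2 ≤ m_ψ` of the theorem fails, and the kernel decides every pair directly: the condition
is sufficient, not necessary (`E2M1` via `E3M2`/`E2M3`/`E4M3` and `E2M3` via `E4M3` are innocuous
for all pairs), but it cannot simply be dropped (`E3M2` via `E4M3` fails on 208 of the 4096
ordered pairs, e.g. `5/2 + 3/16`). -/

/-- `E2M1` via `E3M2`: innocuous for ALL `16²` pairs (kernel exhaustion; the theorem's precision
hypothesis `4 ≤ 2` fails, so this is not an instance). [folklore] -/
theorem E2M1_add_via_E3M2_all (a b : MiniFloat E2M1) :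
    (roundNE E2M1 (roundNE E3M2 (a.toRat + b.toRat)).toRat).toRat
      = (roundNE E2M1 (a.toRat + b.toRat)).toRat :=
  of_decide_eq_true (forall₂_of_all_all (P := fun a b : MiniFloat E2M1 =>
    decide ((roundNE E2M1 (roundNE E3M2 (a.toRat + b.toRat)).toRat).toRat
      = (roundNE E2M1 (a.toRat + b.toRat)).toRat)) (by decide +kernel) a b)

/-- `E2M1` via `E2M3`: innocuous for all pairs (kernel exhaustion). [folklore] -/
theorem E2M1_add_via_E2M3_all (a b : MiniFloat E2M1) :
    (roundNE E2M1 (roundNE E2M3 (a.toRat + b.toRat)).toRat).toRat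
      = (roundNE E2M1 (a.toRat + b.toRat)).toRat :=
  of_decide_eq_true (forall₂_of_all_all (P := fun a b : MiniFloat E2M1 =>
    decide ((roundNE E2M1 (roundNE E2M3 (a.toRat + b.toRat)).toRat).toRat
      = (roundNE E2M1 (a.toRat + b.toRat)).toRat)) (by decide +kernel) a b)

/-- `E2M1` via `E4M3`: innocuous for all pairs (kernel exhaustion). [folklore] -/
theorem E2M1_add_via_E4M3_all (a b : MiniFloat E2M1) :
    (roundNE E2M1 (roundNE E4M3 (a.toRat + b.toRat)).toRat).toRat
      = (roundNE E2M1 (a.toRat + b.toRat)).toRat :=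
  of_decide_eq_true (forall₂_of_all_all (P := fun a b : MiniFloat E2M1 =>
    decide ((roundNE E2M1 (roundNE E4M3 (a.toRat + b.toRat)).toRat).toRat
      = (roundNE E2M1 (a.toRat + b.toRat)).toRat)) (by decide +kernel) a b)

/-- `E2M3` via `E4M3`: innocuous for ALL `64²` pairs (kernel exhaustion; `2·3 + 2 = 8 > 3`, not an
instance of the theorem — every `E2M3 + E2M3` is a multiple of `1/8` of magnitude `≤ 15`, and the
few that are not `E4M3` values are `E4M3` ties resolved consistently). [folklore] -/
theorem E2M3_add_via_E4M3_all (a b : MiniFloat E2M3) :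
    (roundNE E2M3 (roundNE E4M3 (a.toRat + b.toRat)).toRat).toRat
      = (roundNE E2M3 (a.toRat + b.toRat)).toRat :=
  of_decide_eq_true (forall₂_of_all_all (P := fun a b : MiniFloat E2M3 =>
    decide ((roundNE E2M3 (roundNE E4M3 (a.toRat + b.toRat)).toRat).toRat
      = (roundNE E2M3 (a.toRat + b.toRat)).toRat)) (by decide +kernel) a b)

/-- `E3M2` via `E4M3` is NOT innocuous: `a = 5/2`, `b = 3/16` (both `E3M2`), `a + b = 43/16`;
`E4M3` rounds it (nearest, no tie) to `11/4`, the `E3M2` midpoint of `5/2` and `3`, which then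
ties to the even `3`; the correctly rounded `E3M2` sum is `5/2`. (One of 208 failing ordered pairs
among `64²`.) [folklore] -/
theorem E3M2_add_via_E4M3_counterexample :
    let a : MiniFloat E3M2 := ⟨false, 4, 1, by decide, by decide, by decide⟩
    let b : MiniFloat E3M2 := ⟨false, 0, 3, by decide, by decide, by decide⟩
    a.toRat = 5 / 2 ∧ b.toRat = 3 / 16 ∧
    (roundNE E4M3 (a.toRat + b.toRat)).toRat = 11 / 4 ∧
    (roundNE E3M2 (roundNE E4M3 (a.toRat + b.toRat)).toRat).toRat = 3 ∧
    (roundNE E3M2 (a.toRat + b.toRat)).toRat = 5 / 2 := by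
  decide +kernel

/-- Hence the general statement fails for (`E3M2`, `E4M3`). [folklore] -/
theorem E3M2_add_via_E4M3_not_innocuous :
    ¬ ∀ a b : MiniFloat E3M2, (roundNE E3M2 (roundNE E4M3 (a.toRat + b.toRat)).toRat).toRat
      = (roundNE E3M2 (a.toRat + b.toRat)).toRat := by
  intro h
  have h1 := h ⟨false, 4, 1, by decide, by decide, by decide⟩ ⟨false, 0, 3, by decide, by decide, by decide⟩
  obtain ⟨-, -, -, h2, h3⟩ := E3M2_add_via_E4M3_counterexample
  rw [h2, h3] at h1
  norm_num at h1

end Format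

end Literature.ComputerArithmetic.FloatingPoint
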